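import Summits.KontsevichZagierPeriods.KontsevichZagierPeriods.Theses.FermatIsogeny
import Summits.KontsevichZagierPeriods.KontsevichZagierPeriods.Theorems.TerasomaMultiplicationGammaHodgeSectorStubProducts

/-!
# `FermatSectorComplete` (stmt-KontsevichZagierPeriods-14252), line `birth` — the β-LINEAR axioms
# are subsumed by the β-PRODUCT axioms modulo the moves

Route FermatIsogeny grants two families of extra axioms to the KZ calculus: `S_lin`, the formal
differences `[ρ] − [ρ']` of the hypothesis pairs of `BetaLinearSector` (crux 3: a 1-dimensional
Beta representation `[(0,1), t^{a−1}(1−t)^{b−1}]` and a real-algebraic multiple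
`[(0,1), c·t^{a'−1}(1−t)^{b'−1}]` of another one, of equal value), and `S_prod`, those of
`BetaProductSector` (crux 4: the 2-dimensional analogues on `(0,1)²` with four exponents and a
scalar `q`). OBSERVATION formalised here: an `S_lin` pair, PADDED by the factor `β(1,1) = 1`
(`GammaHodgeSectorKO.stub_betaRelators.2.2.1`, an honest chain of moves), is an `S_prod` pair modulo
`KZ.relations`. Everything is algebra in the formal period ring `P = FormalRep ⧸ relations`:

* `mem_relProd_of_classes` — a formal combination of class
  `β(a,b)β(e,d) − κ(q)·(β(a',b')β(e',d'))` and value `0` lies in `relations ⊔ closure S_prod`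
  (the two cube representations exist, `KZ.exists_cubeBetaRep`; classes by
  `GammaHodgeSectorKO.cubeProduct_holds` and `KZ.toFormalPeriod_of_constMul`; values by `evalP`;
  lift by `KZ.toFormalPeriod_eq_iff`);
* `betaLinearPair_mem_relProd` — every `S_lin` generator lies in `relations ⊔ closure S_prod`
  (`⟦ρ⟧ = β(a,b)·β(1,1)`, `⟦ρ'⟧ = κ(c)·(β(a',b')·β(1,1))`);
* `betaSector_eq_prodSector` — `relations ⊔ closure (S_lin ∪ S_prod) = relations ⊔ closure S_prod`;
* `betaLinearSector_of_betaProductSector` — crux 4 implies crux 3;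
* `fermatSectorComplete_iff_prodForm` — crux 5 is completeness modulo `S_prod` alone;
* `closes_without_betaLinear` — `BetaProductSector → FermatSectorComplete → KontsevichZagierPeriods`:
  the route closes without crux 3.

No transcendence input is used. References: Kontsevich–Zagier 2001 §1.1–1.2, §4.1;
Andrews–Askey–Roy 1999 §1.1.
-/

noncomputable section

open MeasureTheory Set
open scoped BigOperators

namespace Summit.KontsevichZagierPeriods.FermatIsogeny.BetaLinearOfProduct

open Literature.NumberTheory.Transcendental
open Literature.NumberTheory.Transcendental.KZ
open Summit.KontsevichZagierPeriods.GammaHodgeSectorKO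
open Summit.KontsevichZagierPeriods.GammaHodgeSectorNegative (IsCubeBetaRep)
open Summit.KontsevichZagierPeriods.KontsevichZagierPeriods.BetaCancellationNegative
  (betaKernel mem_unitIoo)
open Summit.KontsevichZagierPeriods.KontsevichZagierPeriods.Theses.FermatIsogeny
  (BetaLinearSector BetaProductSector FermatSectorComplete)

/-! ## Classes in `P` of the two representations of a β-linear pair, padded with `β(1,1) = 1` -/

/-- A representation pinned in the route's shape as `[(0,1), t^{a−1}(1−t)^{b−1}]` (`0 < a, b`) has
class `β(a,b)·β(1,1)` in `P`: it is pinned as `β(a,b)` (`IsBetaRep`, up to the spelling of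
`(0,1) ⊆ ℝ¹`), and `β(1,1) = 1` (`stub_betaRelators.2.2.1`). [folklore] -/
theorem toFormalPeriod_of_pinned_beta {a b : ℚ} (ha : 0 < a) (hb : 0 < b) (ρ : IntegralRep 1)
    (hd : ρ.domain = {x | x 0 ∈ Set.Ioo (0:ℝ) 1})
    (hi : Set.EqOn ρ.integrand (fun x => (x 0) ^ ((a:ℝ) - 1) * (1 - x 0) ^ ((b:ℝ) - 1)) ρ.domain) :
    toFormalPeriod (of ρ) = betaClass a b * betaClass 1 1 := by
  rw [stub_betaRelators.2.2.1, mul_one]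
  refine IsBetaRep.toFormalPeriod_eq ha hb ⟨?_, fun x hx => ?_⟩
  · rw [hd]
    ext x
    exact (mem_unitIoo x).symm
  · simp only [hi hx, betaKernel]

/-- A representation pinned in the route's shape as `[(0,1), c·t^{a'−1}(1−t)^{b'−1}]` (`0 < a', b'`,
`c` real algebraic) has class `κ(c)·(β(a',b')·β(1,1))` in `P`: it agrees on its domain with the
scaled Beta representation `c·β(a',b')` (one integrand-additivity move,
`KZ.of_sub_of_mem_relations_of_eqOn`), constants factor out (`KZ.toFormalPeriod_of_constMul`), and
`β(1,1) = 1`. [cite: KontsevichZagier2001, §1.2] -/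
theorem toFormalPeriod_of_pinned_constMul_beta {a' b' : ℚ} (ha' : 0 < a') (hb' : 0 < b') (c : ℝ)
    (hc : IsAlgebraic ℚ c) (ρ' : IntegralRep 1)
    (hd' : ρ'.domain = {x | x 0 ∈ Set.Ioo (0:ℝ) 1})
    (hi' : Set.EqOn ρ'.integrand (fun x => c * (x 0) ^ ((a':ℝ) - 1) * (1 - x 0) ^ ((b':ℝ) - 1))
      ρ'.domain) :
    toFormalPeriod (of ρ') = kap c hc * (betaClass a' b' * betaClass 1 1) := by
  rw [stub_betaRelators.2.2.1, mul_one]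
  have h : toFormalPeriod (of ρ') = toFormalPeriod (of ((betaRep a' b' ha' hb').constMul c hc)) := by
    apply toFormalPeriod_eq_iff.mpr
    refine of_sub_of_mem_relations_of_eqOn ?_ fun x hx => ?_
    · rw [IntegralRep.domain_constMul, betaRep_domain, hd']
      ext x
      exact mem_unitIoo x
    · rw [hi' hx, IntegralRep.integrand_constMul, betaRep_integrand]
      simp only [betaKernel]
      ring
  rw [h, toFormalPeriod_of_constMul c hc, ← betaClass_eq a' b' ha' hb']
  rfl

/-! ## One generator of `S_prod`, realised in `P` -/

/-- **One `S_prod` generator modulo relations.** If a formal combination `c` has class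
`β(a,b)·β(e,d) − κ(q)·(β(a',b')·β(e',d'))` in `P` (all exponents positive rationals, `q` real
algebraic) and evaluates to `0`, then `c ∈ relations ⊔ closure S_prod`: the two cube
representations `ρ₀ = [(0,1)², t₀^{a−1}(1−t₀)^{b−1}t₁^{e−1}(1−t₁)^{d−1}]` and
`ρ₀' = q · [(0,1)², (primed)]` exist (`KZ.exists_cubeBetaRep`), have these classes
(`cubeProduct_holds`, `KZ.toFormalPeriod_of_constMul`), equal values (`evalP`), so
`[ρ₀] − [ρ₀'] ∈ S_prod` and `c − ([ρ₀] − [ρ₀']) ∈ relations` (`KZ.toFormalPeriod_eq_iff`).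
(Same argument as `FermatSectorCompleteShortPairs.mem_relS_of_classes`, which concludes in the
larger subgroup `relations ⊔ closure (S_lin ∪ S_prod)`.) [cite: KontsevichZagier2001, §1.2] -/
theorem mem_relProd_of_classes {a b e d a' b' e' d' : ℚ} (ha : 0 < a) (hb : 0 < b) (he : 0 < e)
    (hd : 0 < d) (ha' : 0 < a') (hb' : 0 < b') (he' : 0 < e') (hd' : 0 < d') (q : ℝ)
    (hq : IsAlgebraic ℚ q) (c : FormalRep)
    (hc : toFormalPeriod c =
      betaClass a b * betaClass e d - kap q hq * (betaClass a' b' * betaClass e' d'))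
    (hv : eval c = 0) :
    c ∈ Literature.NumberTheory.Transcendental.KZ.relations ⊔ AddSubgroup.closure {z : Literature.NumberTheory.Transcendental.KZ.FormalRep | ∃ (a b e d a' b' e' d' : ℚ) (q : ℝ) (ρ ρ' : Literature.NumberTheory.Transcendental.KZ.IntegralRep 2), 0 < a ∧ 0 < b ∧ 0 < e ∧ 0 < d ∧ 0 < a' ∧ 0 < b' ∧ 0 < e' ∧ 0 < d' ∧ IsAlgebraic ℚ q ∧ ρ.domain = {x | ∀ i, x i ∈ Set.Ioo (0:ℝ) 1} ∧ Set.EqOn ρ.integrand (fun x => (x 0) ^ ((a:ℝ) - 1) * (1 - x 0) ^ ((b:ℝ) - 1) * (x 1) ^ ((e:ℝ) - 1) * (1 - x 1) ^ ((d:ℝ) - 1)) ρ.domain ∧ ρ'.domain = {x | ∀ i, x i ∈ Set.Ioo (0:ℝ) 1} ∧ Set.EqOn ρ'.integrand (fun x => q * (x 0) ^ ((a':ℝ) - 1) * (1 - x 0) ^ ((b':ℝ) - 1) * (x 1) ^ ((e':ℝ) - 1) * (1 - x 1) ^ ((d':ℝ) - 1)) ρ'.domain ∧ ρ.value = ρ'.value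 ∧ z = Literature.NumberTheory.Transcendental.KZ.of ρ - Literature.NumberTheory.Transcendental.KZ.of ρ'} := by
  -- the two cube representations on `(0,1)²`
  have hpos₀ : ∀ j : Fin 2, 0 < ![a, e] j ∧ 0 < ![b, d] j :=
    Fin.forall_fin_two.2 ⟨⟨ha, hb⟩, ⟨he, hd⟩⟩
  have hpos₁ : ∀ j : Fin 2, 0 < ![a', e'] j ∧ 0 < ![b', d'] j :=
    Fin.forall_fin_two.2 ⟨⟨ha', hb'⟩, ⟨he', hd'⟩⟩
  obtain ⟨ρ₀, h₀d, h₀i⟩ := exists_cubeBetaRep ![a, e] ![b, d] hpos₀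
  obtain ⟨ρ₁, h₁d, h₁i⟩ := exists_cubeBetaRep ![a', e'] ![b', d'] hpos₁
  -- their classes in `P`
  have hc₀ : toFormalPeriod (of ρ₀) = betaClass a b * betaClass e d := by
    have h := cubeProduct_holds _ _ ρ₀ hpos₀ ⟨h₀d, h₀i⟩
    rw [Fin.prod_univ_two] at h
    exact h
  have hc₁ : toFormalPeriod (of (ρ₁.constMul q hq)) =
      kap q hq * (betaClass a' b' * betaClass e' d') := by
    have h := cubeProduct_holds _ _ ρ₁ hpos₁ ⟨h₁d, h₁i⟩
    rw [Fin.prod_univ_two] at h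
    rw [toFormalPeriod_of_constMul q hq ρ₁, h]
    rfl
  -- the difference has the class of `c`, hence equal values
  have hcs : toFormalPeriod (of ρ₀ - of (ρ₁.constMul q hq)) = toFormalPeriod c := by
    rw [map_sub, hc₀, hc₁, hc]
  have hval : ρ₀.value = (ρ₁.constMul q hq).value := by
    have h : evalP (toFormalPeriod (of ρ₀ - of (ρ₁.constMul q hq))) = evalP (toFormalPeriod c) := by
      rw [hcs]
    rwa [evalP_toFormalPeriod c, hv, map_sub, map_sub, evalP_toFormalPeriod_of,
      evalP_toFormalPeriod_of, sub_eq_zero] at h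
  -- `[ρ₀] − [ρ₀']` is a generator of `S_prod`
  have hs : of ρ₀ - of (ρ₁.constMul q hq) ∈ {z : Literature.NumberTheory.Transcendental.KZ.FormalRep | ∃ (a b e d a' b' e' d' : ℚ) (q : ℝ) (ρ ρ' : Literature.NumberTheory.Transcendental.KZ.IntegralRep 2), 0 < a ∧ 0 < b ∧ 0 < e ∧ 0 < d ∧ 0 < a' ∧ 0 < b' ∧ 0 < e' ∧ 0 < d' ∧ IsAlgebraic ℚ q ∧ ρ.domain = {x | ∀ i, x i ∈ Set.Ioo (0:ℝ) 1} ∧ Set.EqOn ρ.integrand (fun x => (x 0) ^ ((a:ℝ) - 1) * (1 - x 0) ^ ((b:ℝ) - 1) * (x 1) ^ ((e:ℝ) - 1) * (1 - x 1) ^ ((d:ℝ) - 1)) ρ.domain ∧ ρ'.domain = {x | ∀ i, x i ∈ Set.Ioo (0:ℝ) 1} ∧ Set.EqOn ρ'.integrand (fun x => q * (x 0) ^ ((a':ℝ) - 1) * (1 - x 0) ^ ((b':ℝ) - 1) * (x 1) ^ ((e':ℝ) - 1) * (1 - x 1) ^ ((d':ℝ) - 1)) ρ'.domain ∧ ρ.value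 = ρ'.value ∧ z = Literature.NumberTheory.Transcendental.KZ.of ρ - Literature.NumberTheory.Transcendental.KZ.of ρ'} := by
    refine ⟨a, b, e, d, a', b', e', d', q, ρ₀, ρ₁.constMul q hq, ha, hb, he, hd, ha', hb', he',
      hd', hq, h₀d, ?_, h₁d, ?_, hval, rfl⟩
    · intro t ht
      rw [h₀i ht]
      simp only [Fin.prod_univ_two, Matrix.cons_val_zero, Matrix.cons_val_one]
      ring
    · intro t ht
      rw [IntegralRep.integrand_constMul]
      have ht' : t ∈ ρ₁.domain := ht
      simp only [h₁i ht', Fin.prod_univ_two, Matrix.cons_val_zero, Matrix.cons_val_one]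
      ring
  -- lift back to `FormalRep`
  have hrel : c - (of ρ₀ - of (ρ₁.constMul q hq)) ∈ relations := toFormalPeriod_eq_iff.mp hcs.symm
  rw [← sub_add_cancel c (of ρ₀ - of (ρ₁.constMul q hq))]
  exact AddSubgroup.add_mem _ (AddSubgroup.mem_sup_left hrel)
    (AddSubgroup.mem_sup_right (AddSubgroup.subset_closure hs))

/-! ## The β-linear pairs lie in the β-product subgroup -/

/-- **Every `S_lin` generator lies in `relations ⊔ closure S_prod`.** For an `S_lin` pair
(`ρ` pinned as `β(a,b)`, `ρ'` pinned as `c·β(a',b')`, equal values), pad both classes with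
`β(1,1) = 1`: `⟦ρ⟧ = β(a,b)·β(1,1)`, `⟦ρ'⟧ = κ(c)·(β(a',b')·β(1,1))`, and apply
`mem_relProd_of_classes`. [cite: KontsevichZagier2001, §1.2] -/
theorem betaLinearPair_mem_relProd :
    ∀ (a b a' b' : ℚ) (c : ℝ), 0 < a → 0 < b → 0 < a' → 0 < b' → IsAlgebraic ℚ c → ∀ (ρ ρ' : Literature.NumberTheory.Transcendental.KZ.IntegralRep 1), ρ.domain = {x | x 0 ∈ Set.Ioo (0:ℝ) 1} → Set.EqOn ρ.integrand (fun x => (x 0) ^ ((a:ℝ) - 1) * (1 - x 0) ^ ((b:ℝ) - 1)) ρ.domain → ρ'.domain = {x | x 0 ∈ Set.Ioo (0:ℝ) 1} → Set.EqOn ρ'.integrand (fun x => c * (x 0) ^ ((a':ℝ) - 1) * (1 - x 0) ^ ((b':ℝ) - 1)) ρ'.domain → ρ.value = ρ'.value → Literature.NumberTheory.Transcendental.KZ.of ρ - Literature.NumberTheory.Transcendental.KZ.of ρ' ∈ Literature.NumberTheory.Transcendental.KZ.relations ⊔ AddSubgroup.closure {z : Literature.NumberTheory.Transcendental.KZ.FormalRep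 | ∃ (a b e d a' b' e' d' : ℚ) (q : ℝ) (ρ ρ' : Literature.NumberTheory.Transcendental.KZ.IntegralRep 2), 0 < a ∧ 0 < b ∧ 0 < e ∧ 0 < d ∧ 0 < a' ∧ 0 < b' ∧ 0 < e' ∧ 0 < d' ∧ IsAlgebraic ℚ q ∧ ρ.domain = {x | ∀ i, x i ∈ Set.Ioo (0:ℝ) 1} ∧ Set.EqOn ρ.integrand (fun x => (x 0) ^ ((a:ℝ) - 1) * (1 - x 0) ^ ((b:ℝ) - 1) * (x 1) ^ ((e:ℝ) - 1) * (1 - x 1) ^ ((d:ℝ) - 1)) ρ.domain ∧ ρ'.domain = {x | ∀ i, x i ∈ Set.Ioo (0:ℝ) 1} ∧ Set.EqOn ρ'.integrand (fun x => q * (x 0) ^ ((a':ℝ) - 1) * (1 - x 0) ^ ((b':ℝ) - 1) * (x 1) ^ ((e':ℝ) - 1) * (1 - x 1) ^ ((d':ℝ) - 1)) ρ'.domain ∧ ρ.value = ρ'.value ∧ z = Literature.NumberTheory.Transcendental.KZ.of ρ - Literature.NumberTheory.Transcendental.KZ.of ρ'} := by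
  intro a b a' b' c ha hb ha' hb' hc ρ ρ' hd hi hd' hi' hval
  refine mem_relProd_of_classes ha hb one_pos one_pos ha' hb' one_pos one_pos c hc (of ρ - of ρ')
    ?_ ?_
  · rw [map_sub, toFormalPeriod_of_pinned_beta ha hb ρ hd hi,
      toFormalPeriod_of_pinned_constMul_beta ha' hb' c hc ρ' hd' hi']
  · rw [map_sub, eval_of, eval_of, hval, sub_self]

/-- **The β-sector subgroup is the β-product subgroup**:
`relations ⊔ closure (S_lin ∪ S_prod) = relations ⊔ closure S_prod` — `≤` because every `S_lin`
generator lies in the right-hand side (`betaLinearPair_mem_relProd`), `≥` by monotonicity.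
[cite: KontsevichZagier2001, §1.2] -/
theorem betaSector_eq_prodSector :
    Literature.NumberTheory.Transcendental.KZ.relations ⊔ AddSubgroup.closure ({z : Literature.NumberTheory.Transcendental.KZ.FormalRep | ∃ (a b a' b' : ℚ) (c : ℝ) (ρ ρ' : Literature.NumberTheory.Transcendental.KZ.IntegralRep 1), 0 < a ∧ 0 < b ∧ 0 < a' ∧ 0 < b' ∧ IsAlgebraic ℚ c ∧ ρ.domain = {x | x 0 ∈ Set.Ioo (0:ℝ) 1} ∧ Set.EqOn ρ.integrand (fun x => (x 0) ^ ((a:ℝ) - 1) * (1 - x 0) ^ ((b:ℝ) - 1)) ρ.domain ∧ ρ'.domain = {x | x 0 ∈ Set.Ioo (0:ℝ) 1} ∧ Set.EqOn ρ'.integrand (fun x => c * (x 0) ^ ((a':ℝ) - 1) * (1 - x 0) ^ ((b':ℝ) - 1)) ρ'.domain ∧ ρ.value = ρ'.value ∧ z = Literature.NumberTheory.Transcendental.KZ.of ρ - Literature.NumberTheory.Transcendental.KZ.of ρ'} ∪ {z : Literature.NumberTheory.Transcendental.KZ.FormalRep | ∃ (a b e d a' b' e' d' : ℚ) (q : ℝ)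 (ρ ρ' : Literature.NumberTheory.Transcendental.KZ.IntegralRep 2), 0 < a ∧ 0 < b ∧ 0 < e ∧ 0 < d ∧ 0 < a' ∧ 0 < b' ∧ 0 < e' ∧ 0 < d' ∧ IsAlgebraic ℚ q ∧ ρ.domain = {x | ∀ i, x i ∈ Set.Ioo (0:ℝ) 1} ∧ Set.EqOn ρ.integrand (fun x => (x 0) ^ ((a:ℝ) - 1) * (1 - x 0) ^ ((b:ℝ) - 1) * (x 1) ^ ((e:ℝ) - 1) * (1 - x 1) ^ ((d:ℝ) - 1)) ρ.domain ∧ ρ'.domain = {x | ∀ i, x i ∈ Set.Ioo (0:ℝ) 1} ∧ Set.EqOn ρ'.integrand (fun x => q * (x 0) ^ ((a':ℝ) - 1) * (1 - x 0) ^ ((b':ℝ) - 1) * (x 1) ^ ((e':ℝ) - 1) * (1 - x 1) ^ ((d':ℝ) - 1)) ρ'.domain ∧ ρ.value = ρ'.value ∧ z = Literature.NumberTheory.Transcendental.KZ.of ρ - Literature.NumberTheory.Transcendental.KZ.of ρ'}) =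
      Literature.NumberTheory.Transcendental.KZ.relations ⊔ AddSubgroup.closure {z : Literature.NumberTheory.Transcendental.KZ.FormalRep | ∃ (a b e d a' b' e' d' : ℚ) (q : ℝ) (ρ ρ' : Literature.NumberTheory.Transcendental.KZ.IntegralRep 2), 0 < a ∧ 0 < b ∧ 0 < e ∧ 0 < d ∧ 0 < a' ∧ 0 < b' ∧ 0 < e' ∧ 0 < d' ∧ IsAlgebraic ℚ q ∧ ρ.domain = {x | ∀ i, x i ∈ Set.Ioo (0:ℝ) 1} ∧ Set.EqOn ρ.integrand (fun x => (x 0) ^ ((a:ℝ) - 1) * (1 - x 0) ^ ((b:ℝ) - 1) * (x 1) ^ ((e:ℝ) - 1) * (1 - x 1) ^ ((d:ℝ) - 1)) ρ.domain ∧ ρ'.domain = {x | ∀ i, x i ∈ Set.Ioo (0:ℝ) 1} ∧ Set.EqOn ρ'.integrand (fun x => q * (x 0) ^ ((a':ℝ) - 1) * (1 - x 0) ^ ((b':ℝ) - 1) * (x 1) ^ ((e':ℝ) - 1) * (1 - x 1) ^ ((d':ℝ) - 1)) ρ'.domain ∧ ρ.value = ρ'.value ∧ z = Literature.NumberTheory.Transcendental.KZ.of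 ρ - Literature.NumberTheory.Transcendental.KZ.of ρ'} := by
  refine le_antisymm (sup_le le_sup_left ((AddSubgroup.closure_le _).mpr ?_))
    (sup_le_sup_left (AddSubgroup.closure_mono Set.subset_union_right) _)
  rintro z (⟨a, b, a', b', c, ρ, ρ', ha, hb, ha', hb', hc, hd, hi, hd', hi', hv, rfl⟩ | hz)
  · exact betaLinearPair_mem_relProd a b a' b' c ha hb ha' hb' hc ρ ρ' hd hi hd' hi' hv
  · exact AddSubgroup.mem_sup_right (AddSubgroup.subset_closure hz)

/-! ## Crux 4 implies crux 3 -/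

/-- **`BetaProductSector → BetaLinearSector` (crux 4 implies crux 3).** Given an `S_lin` pair
`(ρ, ρ')`, let `ρ₀` be the cube representation of `(![a,1], ![b,1])` and `ρ₁ := c ·` (cube
representation of `(![a',1], ![b',1])`) (`KZ.exists_cubeBetaRep`, `constMul`). In `P`,
`⟦ρ₀⟧ = β(a,b)β(1,1) = ⟦ρ⟧` and `⟦ρ₁⟧ = κ(c)(β(a',b')β(1,1)) = ⟦ρ'⟧` (`cubeProduct_holds`,
`KZ.toFormalPeriod_of_constMul`, `β(1,1) = 1`), so `ρ₀, ρ₁` have equal values (`evalP`) and form a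
hypothesis instance of `BetaProductSector` with `e = d = e' = d' = 1`; hence `⟦ρ₀⟧ = ⟦ρ₁⟧`, so
`⟦ρ⟧ = ⟦ρ'⟧`, i.e. `Equivalent ρ ρ'` (`KZ.toFormalPeriod_eq_iff`). [cite: KontsevichZagier2001, §1.2] -/
theorem betaLinearSector_of_betaProductSector :
    Summit.KontsevichZagierPeriods.KontsevichZagierPeriods.Theses.FermatIsogeny.BetaProductSector → Summit.KontsevichZagierPeriods.KontsevichZagierPeriods.Theses.FermatIsogeny.BetaLinearSector := by
  intro h₄ a b a' b' c ha hb ha' hb' hc ρ ρ' hd hi hd' hi' hval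
  have h1 : toFormalPeriod (of ρ) = betaClass a b * betaClass 1 1 :=
    toFormalPeriod_of_pinned_beta ha hb ρ hd hi
  have h2 : toFormalPeriod (of ρ') = kap c hc * (betaClass a' b' * betaClass 1 1) :=
    toFormalPeriod_of_pinned_constMul_beta ha' hb' c hc ρ' hd' hi'
  -- the padded cube representations on `(0,1)²`
  have hpos₀ : ∀ j : Fin 2, 0 < ![a, 1] j ∧ 0 < ![b, 1] j :=
    Fin.forall_fin_two.2 ⟨⟨ha, hb⟩, ⟨one_pos, one_pos⟩⟩
  have hpos₁ : ∀ j : Fin 2, 0 < ![a', 1] j ∧ 0 < ![b', 1] j :=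
    Fin.forall_fin_two.2 ⟨⟨ha', hb'⟩, ⟨one_pos, one_pos⟩⟩
  obtain ⟨ρ₀, h₀d, h₀i⟩ := exists_cubeBetaRep ![a, 1] ![b, 1] hpos₀
  obtain ⟨ρ₁, h₁d, h₁i⟩ := exists_cubeBetaRep ![a', 1] ![b', 1] hpos₁
  have hc₀ : toFormalPeriod (of ρ₀) = betaClass a b * betaClass 1 1 := by
    have h := cubeProduct_holds _ _ ρ₀ hpos₀ ⟨h₀d, h₀i⟩
    rw [Fin.prod_univ_two] at h
    exact h
  have hc₁ : toFormalPeriod (of (ρ₁.constMul c hc)) = kap c hc * (betaClass a' b' * betaClass 1 1) := by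
    have h := cubeProduct_holds _ _ ρ₁ hpos₁ ⟨h₁d, h₁i⟩
    rw [Fin.prod_univ_two] at h
    rw [toFormalPeriod_of_constMul c hc ρ₁, h]
    rfl
  -- equal values, through the classes
  have hval' : ρ₀.value = (ρ₁.constMul c hc).value := by
    rw [← evalP_toFormalPeriod_of ρ₀, ← evalP_toFormalPeriod_of (ρ₁.constMul c hc), hc₀, hc₁, ← h1,
      ← h2, evalP_toFormalPeriod_of, evalP_toFormalPeriod_of, hval]
  -- the β-product axiom for the padded pair
  have hE : Equivalent ρ₀ (ρ₁.constMul c hc) := by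
    refine h₄ a b 1 1 a' b' 1 1 c ha hb one_pos one_pos ha' hb' one_pos one_pos hc ρ₀
      (ρ₁.constMul c hc) h₀d ?_ h₁d ?_ hval'
    · intro t ht
      rw [h₀i ht]
      simp only [Fin.prod_univ_two, Matrix.cons_val_zero, Matrix.cons_val_one]
      ring
    · intro t ht
      rw [IntegralRep.integrand_constMul]
      have ht' : t ∈ ρ₁.domain := ht
      simp only [h₁i ht', Fin.prod_univ_two, Matrix.cons_val_zero, Matrix.cons_val_one]
      ring
  -- cancel `β(1,1) = 1` (already folded into `h1`, `h2`) and lift to `FormalRep`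
  exact toFormalPeriod_eq_iff.mp
    (h1.trans (hc₀.symm.trans (hE.toFormalPeriod_eq.trans (hc₁.trans h2.symm))))

/-! ## Crux 5 in product form, and the route without crux 3 -/

/-- **`FermatSectorComplete` ⟺ completeness modulo `S_prod` alone**: rational representations of
equal value differ by an element of `relations ⊔ closure S_prod` (rewrite the subgroup by
`betaSector_eq_prodSector`). [cite: KontsevichZagier2001, §1.2] -/
theorem fermatSectorComplete_iff_prodForm :
    FermatSectorComplete ↔ ∀ ⦃n m : ℕ⦄ (r : Literature.NumberTheory.Transcendental.KZ.IntegralRep n) (r' : Literature.NumberTheory.Transcendental.KZ.IntegralRep m), r.IsRational → r'.IsRational → r.value = r'.value → Literature.NumberTheory.Transcendental.KZ.of r - Literature.NumberTheory.Transcendental.KZ.of r' ∈ Literature.NumberTheory.Transcendental.KZ.relations ⊔ AddSubgroup.closure {z : Literature.NumberTheory.Transcendental.KZ.FormalRep | ∃ (a b e d a' b' e' d' : ℚ) (q : ℝ) (ρ ρ' : Literature.NumberTheory.Transcendental.KZ.IntegralRep 2), 0 < a ∧ 0 < b ∧ 0 < e ∧ 0 < d ∧ 0 < a' ∧ 0 <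 b' ∧ 0 < e' ∧ 0 < d' ∧ IsAlgebraic ℚ q ∧ ρ.domain = {x | ∀ i, x i ∈ Set.Ioo (0:ℝ) 1} ∧ Set.EqOn ρ.integrand (fun x => (x 0) ^ ((a:ℝ) - 1) * (1 - x 0) ^ ((b:ℝ) - 1) * (x 1) ^ ((e:ℝ) - 1) * (1 - x 1) ^ ((d:ℝ) - 1)) ρ.domain ∧ ρ'.domain = {x | ∀ i, x i ∈ Set.Ioo (0:ℝ) 1} ∧ Set.EqOn ρ'.integrand (fun x => q * (x 0) ^ ((a':ℝ) - 1) * (1 - x 0) ^ ((b':ℝ) - 1) * (x 1) ^ ((e':ℝ) - 1) * (1 - x 1) ^ ((d':ℝ) - 1)) ρ'.domain ∧ ρ.value = ρ'.value ∧ z = Literature.NumberTheory.Transcendental.KZ.of ρ - Literature.NumberTheory.Transcendental.KZ.of ρ'} := by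
  constructor
  · intro h n m r r' hr hr' hv
    exact betaSector_eq_prodSector.le (h r r' hr hr' hv)
  · intro h n m r r' hr hr' hv
    exact betaSector_eq_prodSector.ge (h r r' hr hr' hv)

/-- **The route closes without crux 3**: `BetaProductSector → FermatSectorComplete →
KontsevichZagierPeriods`, by the deciding theorem `closes` of route FermatIsogeny with
`BetaLinearSector` supplied by `betaLinearSector_of_betaProductSector`. [cite: KontsevichZagier2001, §1.2] -/
theorem closes_without_betaLinear :
    BetaProductSector → FermatSectorComplete → _root_.KontsevichZagierPeriods :=
  fun h₄ h₅ => Summit.KontsevichZagierPeriods.KontsevichZagierPeriods.Theses.FermatIsogeny.closes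
    (betaLinearSector_of_betaProductSector h₄) h₄ h₅

end Summit.KontsevichZagierPeriods.FermatIsogeny.BetaLinearOfProduct

end
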